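/-
Copyright (c) 2026 the pub-hodgecm-mathlib formalisation cell (harness21).  Prover seat hodgecm-mathlib-LH7-p04 (g10), 2026-09-02 — road «ELL-INNER» (map owner LH6-p03 (g7)), piece (E0b) «LANDING».
The embedded `H_v`-Cartans land in the ELLIPTIC `G`-Cartan system: the `hcovE` letter of (E0) «G-REGROUP» discharged from RUNG0 v8's `hcovGO`.
-/
import Summits.HodgeConjecture.HodgeConjecture.Theorems.F0P3cStCharTSCartanReps      -- ★ `not_conj_cmTorus_of_isCompact` (a compact subgroup is not conjugate to the split torus `M`; over ★ `not_isCompact_cmTorus`)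
import Literature.NumberTheory.Rogawski1990.CMLocalAPacketMembers                     -- ★ `Gqs`, `qsForm` (the quasi-split carrier abbreviations of the (E0)∕(E8) letters)
import Mathlib.Topology.Algebra.ContinuousMonoidHom
import HarnessLib

/-!
# (E0b) «LANDING»: the embedded compact `H_v`-Cartans land in `Sell`, never in the split torus `M`

Cell `pub/hodgecm-mathlib`, crux H413 = `stmt-HodgeConjecture-24833` (lane `--supports`, count-neutral), road «ELL-INNER» (map owner LH6-p03 (g7); LEAD F0P3a-plan (g15);
desk F0P3-plan (g18)).  THEOREMS ONLY (no definition ∕ instance ∕ notation ∕ named fact ∕ `sorry`); ★-only imports.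

WHAT.  The (E0) «G-REGROUP» head (LH6-p03 (g7), `Theorems/F0P3cStCharTSEllInnerGRegroup.lean`) carries the by-shape binder
`hcovE : ∀ T ∈ SH, ∀ i : Fin (n T), ∃ T₀ ∈ Sell, ∃ y : Gqs L v, ∀ g : Gqs L v, g ∈ Z_G(γc T i) ↔ y⁻¹ * g * y ∈ T₀` — «the `G`-Cartan `Z_G(γc T i)` that the compact
`H_v`-Cartan `T` embeds into (via `eT T i : ↥T ≃ₜ* ↥Z_G(γc T i)`) is conjugate to a member of the ELLIPTIC system `Sell`».  RUNG0 v8 (`Theorems/F0P3cStCharTSRung0Eight.lean` :137)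
supplies only `hcovGO : ∀ γ regular, ∃ T' ∈ insert M Sell, ∃ x, ∀ g, g ∈ Z_G(γ) ↔ x⁻¹ * g * x ∈ T'`, whose cover lands in `insert M Sell` with `M = (cmBorelTriple L 3 v).M` the split
torus.  Since `Z_G(γc T i)` is compact (homeomorphic to the compact `T`, letter `hKH`) and a compact subgroup is never conjugate to the non-compact `M` (★
`F0P3cStCharTSCartanReps.not_conj_cmTorus_of_isCompact` over ★ `F0P3cStCharTSCartanFields.not_isCompact_cmTorus`), the member `T'` lies in `Sell`.  This file proves exactly that:
`covE_of_covGO`, conclusion = the `hcovE` letter TOKEN FOR TOKEN, hypotheses = the (E0)∕(A1′)-E letters `SH n γc hγc eT hKH Sell` + RUNG0 v8's `hcovGO` text with `Sell` free.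
[Rogawski1990, §3.6 pp. 28–31 (Cartan subgroups of `U(3)`: the split torus and the elliptic ones); §12.5 p. 184]

HONEST LABEL.  Count-neutral plumbing (no organ of the h413 closer is paid by this file alone); HC_CM is proved only modulo the cell's remaining named inputs
(hLiu418, h413) until rung 0 closes.
-/

set_option autoImplicit false
set_option linter.dupNamespace false

noncomputable section

open scoped Matrix MatrixGroups
open NumberField IsDedekindDomain
open Literature.NumberTheory.Rogawski1990 Literature.NumberTheory.Automorphic Literature.NumberTheory.Automorphic.UnitaryGroup
  Literature.NumberTheory.GaloisRepresentations

namespace Summit.HodgeConjecture.HodgeConjecture.Cruxes.H413.F0P3cStCharTSEllInnerCoverLanding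

variable (L : Type) [Field L] [NumberField L] [IsCMField L] (v : HeightOneSpectrum (𝓞 ↥(maximalRealSubfield L)))

open scoped Classical in
/-- **A compact centraliser covered by `insert M Sell` is covered by `Sell`**: if `Z_G(γ)` is compact and conjugate (in the `hcovGO` letter's `x⁻¹ g x` spelling) to a member
of `insert (cmBorelTriple L 3 v).M Sell`, that member lies in `Sell` — the split torus `M` is not compact (★ `not_conj_cmTorus_of_isCompact`).
[cite: Rogawski1990, §3.6 pp. 28–31; §12.2 p. 173] -/
theorem exists_mem_of_mem_insert_cmTorus_of_isCompact {γ : Gqs L v}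
    (hZc : IsCompact ((Subgroup.centralizer ({γ} : Set (Gqs L v)) : Subgroup (Gqs L v)) : Set (Gqs L v)))
    {Sell : Finset (Subgroup (Gqs L v))} {T' : Subgroup (Gqs L v)} (hT' : T' ∈ insert (cmBorelTriple L 3 v).M Sell) {x : Gqs L v}
    (hx : ∀ g : Gqs L v, g ∈ Subgroup.centralizer ({γ} : Set (Gqs L v)) ↔ x⁻¹ * g * x ∈ T') :
    ∃ T₀ ∈ Sell, ∃ y : Gqs L v, ∀ g : Gqs L v, g ∈ Subgroup.centralizer ({γ} : Set (Gqs L v)) ↔ y⁻¹ * g * y ∈ T₀ := by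
  rcases Finset.mem_insert.1 hT' with hM | hSell
  · subst hM
    exact absurd hx (F0P3cStCharTSCartanReps.not_conj_cmTorus_of_isCompact L v hZc x)
  · exact ⟨T', hSell, x, hx⟩

open scoped Classical in
/-- **(E0b) «LANDING» — the `hcovE` letter of (E0) «G-REGROUP» from RUNG0 v8's `hcovGO`.**  For the `H_v`-Cartan system `SH` (each `T ∈ SH` compact, `hKH`) with its
embeddings `eT T i : ↥T ≃ₜ* ↥Z_G(γc T i)` at `G`-regular base points `γc T i` (`hγc`), and the `G`-side cover `hcovGO` landing in `insert M Sell` (RUNG0 v8 :137, `Sell` free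
here): every `Z_G(γc T i)` is conjugate to a member of `Sell` — it is compact (image of `T` under the homeomorphism `eT T i`), and compact subgroups are not conjugate to
the split torus `M`.  Conclusion = the (E0) binder `hcovE` token for token. [cite: Rogawski1990, §3.6 pp. 28–31; §12.5 p. 184] -/
theorem covE_of_covGO
    (SH : Finset (Subgroup ((UnitaryGroup.cmDatum L 2 (Matrix.of fun i j : Fin 2 => if i.val + j.val + 1 = 2 then (1 : L) else 0)).Local v × (UnitaryGroup.cmDatum L 1 (Matrix.of fun i j : Fin 1 => if i.val + j.val + 1 = 1 then (1 : L) else 0)).Local v)))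
    (n : Subgroup ((UnitaryGroup.cmDatum L 2 (Matrix.of fun i j : Fin 2 => if i.val + j.val + 1 = 2 then (1 : L) else 0)).Local v × (UnitaryGroup.cmDatum L 1 (Matrix.of fun i j : Fin 1 => if i.val + j.val + 1 = 1 then (1 : L) else 0)).Local v) → ℕ)
    (γc : (T : Subgroup ((UnitaryGroup.cmDatum L 2 (Matrix.of fun i j : Fin 2 => if i.val + j.val + 1 = 2 then (1 : L) else 0)).Local v × (UnitaryGroup.cmDatum L 1 (Matrix.of fun i j : Fin 1 => if i.val + j.val + 1 = 1 then (1 : L) else 0)).Local v)) → Fin (n T) → Gqs L v)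
    (hγc : ∀ T ∈ SH, ∀ i : Fin (n T), IsRegularElt ((γc T i).val : GL (Fin 3) (UnitaryGroup.LocalRing L v)))
    (eT : (T : Subgroup ((UnitaryGroup.cmDatum L 2 (Matrix.of fun i j : Fin 2 => if i.val + j.val + 1 = 2 then (1 : L) else 0)).Local v × (UnitaryGroup.cmDatum L 1 (Matrix.of fun i j : Fin 1 => if i.val + j.val + 1 = 1 then (1 : L) else 0)).Local v)) → (i : Fin (n T)) → (↥T ≃ₜ* ↥(Subgroup.centralizer ({γc T i} : Set (Gqs L v)))))
    (hKH : ∀ T ∈ SH, IsCompact (T : Set ((UnitaryGroup.cmDatum L 2 (Matrix.of fun i j : Fin 2 => if i.val + j.val + 1 = 2 then (1 : L) else 0)).Local v × (UnitaryGroup.cmDatum L 1 (Matrix.of fun i j : Fin 1 => if i.val + j.val + 1 = 1 then (1 : L) else 0)).Local v)))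
    (Sell : Finset (Subgroup (Gqs L v)))
    (hcovGO : ∀ γ : Gqs L v, IsRegularElt (γ.val : GL (Fin 3) (UnitaryGroup.LocalRing L v)) →
      ∃ T' ∈ insert (cmBorelTriple L 3 v).M Sell, ∃ x : Gqs L v, ∀ g : Gqs L v, g ∈ Subgroup.centralizer ({γ} : Set (Gqs L v)) ↔ x⁻¹ * g * x ∈ T') :
    ∀ T ∈ SH, ∀ i : Fin (n T), ∃ T₀ ∈ Sell, ∃ y : Gqs L v,
      ∀ g : Gqs L v, g ∈ Subgroup.centralizer ({γc T i} : Set (Gqs L v)) ↔ y⁻¹ * g * y ∈ T₀ := by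
  intro T hT i
  -- `Z_G(γc T i)` is compact: homeomorphic image of the compact `T`
  haveI : CompactSpace ↥T := isCompact_iff_compactSpace.1 (hKH T hT)
  haveI : CompactSpace ↥(Subgroup.centralizer ({γc T i} : Set (Gqs L v))) := (eT T i).toHomeomorph.compactSpace
  have hZc : IsCompact ((Subgroup.centralizer ({γc T i} : Set (Gqs L v)) : Subgroup (Gqs L v)) : Set (Gqs L v)) :=
    isCompact_iff_compactSpace.2 inferInstance
  obtain ⟨T', hT', x, hx⟩ := hcovGO (γc T i) (hγc T hT i)
  exact exists_mem_of_mem_insert_cmTorus_of_isCompact L v hZc hT' hx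

end Summit.HodgeConjecture.HodgeConjecture.Cruxes.H413.F0P3cStCharTSEllInnerCoverLanding

end
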